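import Summits.ValiantsHypothesis.ValiantsHypothesis.Theorems.LacunarySymmetroidMatrixDescartesFlagAsymptotics

/-!
# `MatrixDescartes` census — FLAG ASYMPTOTICS with a vanishing perturbation (two-flag version)

HONEST FRAMING.  Object-search cell `pub-symmetroid`, crux `Theses.LacunarySymmetroid.MatrixDescartes`
(stmt-ValiantsHypothesis-18050); seat val-sym-mdr-p1 (g2).  Pure lemma file (no definitions, no claims about the crux or `VP ≠ VNP`),
companion of `…FlagAsymptotics`: the same limit and sign statements when the base matrix is a CONVERGENT SEQUENCE `M_D → M₀` (as when a
second flag letter, acting at the other end of the positive axis, is exponentially small at the test point):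

  `det (M_D + diagonal (σ_a r_a^D)) / ∏_{ON} (σ_a r_a^D) ⟶ det (M₀ | OFF)`   (`tendsto_det_add_diagonal_div_of_tendsto`),

and the eventual sign `sign (∏_{ON} σ_a) · sign det(M₀|OFF)` (`eventually_det_mul_pos_of_tendsto`).  Used for the two-sided (K = 4) Lagrange
tower. [folklore]
-/

-- `Summit.ValiantsHypothesis.ValiantsHypothesis.…` repeats a component by the D-0017 layout
-- (single-conjunct summit), which the `dupNamespace` linter flags; the name is mandated.
set_option linter.dupNamespace false

namespace Summit.ValiantsHypothesis.ValiantsHypothesis.Theorems.LacunarySymmetroidMatrixDescartes.Census.Flag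

open Matrix Finset Filter Topology
open scoped BigOperators

variable {ι : Type*} [Fintype ι] [DecidableEq ι]

/-- **FLAG ASYMPTOTICS with a convergent base (limit form).**  If `M_D → M₀`, then for nonzero signs `σ_a` and positive ratios `r_a ≠ 1`,
with `ON = {a : 1 < r_a}`, `det (M_D + diagonal (σ_a r_a^D)) / ∏_{ON} (σ_a r_a^D) → det (M₀ | ONᶜ)`. [folklore] -/
theorem tendsto_det_add_diagonal_div_of_tendsto (M : ℕ → Matrix ι ι ℝ) (M₀ : Matrix ι ι ℝ)
    (hM : Tendsto M atTop (𝓝 M₀)) (σ r : ι → ℝ) (hσ : ∀ a, σ a ≠ 0)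
    (hr : ∀ a, 0 < r a) (hr1 : ∀ a, r a ≠ 1) :
    Tendsto (fun D : ℕ => (M D + diagonal (fun a => σ a * r a ^ D)).det /
        ∏ a ∈ univ.filter (fun a => 1 < r a), (σ a * r a ^ D)) atTop
      (𝓝 ((M₀.submatrix ((↑) : ↥(univ.filter (fun a => 1 < r a))ᶜ → ι)
        ((↑) : ↥(univ.filter (fun a => 1 < r a))ᶜ → ι)).det)) := by
  classical
  set ON := univ.filter (fun a => 1 < r a) with hON
  set OFF := ONᶜ with hOFF
  let c : ℕ → Finset ι → ℝ := fun D S =>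
    (∏ a ∈ Sᶜ, σ a) / (∏ a ∈ ON, σ a) * ((M D).submatrix ((↑) : S → ι) ((↑) : S → ι)).det
  let c₀ : Finset ι → ℝ := fun S =>
    (∏ a ∈ Sᶜ, σ a) / (∏ a ∈ ON, σ a) * (M₀.submatrix ((↑) : S → ι) ((↑) : S → ι)).det
  let ρ : Finset ι → ℝ := fun S => (∏ a ∈ Sᶜ, r a) / ∏ a ∈ ON, r a
  have hσON : ∏ a ∈ ON, σ a ≠ 0 := Finset.prod_ne_zero_iff.mpr fun a _ => hσ a
  have hrON : 0 < ∏ a ∈ ON, r a := Finset.prod_pos fun a _ => hr a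
  have key : ∀ D : ℕ, (M D + diagonal (fun a => σ a * r a ^ D)).det / ∏ a ∈ ON, (σ a * r a ^ D)
      = ∑ S : Finset ι, c D S * ρ S ^ D := by
    intro D
    rw [Literature.Analysis.Matrix.det_add_diagonal_eq_sum_minors, Finset.sum_div]
    refine Finset.sum_congr rfl fun S _ => ?_
    simp only [c, ρ, Finset.prod_mul_distrib, Finset.prod_pow, div_pow]
    have h1 : (∏ a ∈ ON, r a) ^ D ≠ 0 := pow_ne_zero _ hrON.ne'
    field_simp
  simp_rw [key]
  -- every minor converges
  have hc : ∀ S : Finset ι, Tendsto (fun D => c D S) atTop (𝓝 (c₀ S)) := by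
    intro S
    have h1 : Tendsto (fun D => ((M D).submatrix ((↑) : S → ι) ((↑) : S → ι)).det) atTop
        (𝓝 ((M₀.submatrix ((↑) : S → ι) ((↑) : S → ι)).det)) := by
      have hcont : Continuous fun X : Matrix ι ι ℝ => (X.submatrix ((↑) : S → ι) ((↑) : S → ι)).det :=
        (continuous_id.matrix_submatrix _ _).matrix_det
      exact (hcont.tendsto M₀).comp hM
    exact h1.const_mul _
  have hlim : (M₀.submatrix ((↑) : OFF → ι) ((↑) : OFF → ι)).det
      = ∑ S : Finset ι, (if S = OFF then (M₀.submatrix ((↑) : OFF → ι) ((↑) : OFF → ι)).det else 0) := by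
    simp only [Finset.sum_ite_eq', Finset.mem_univ, if_true]
  rw [hlim]
  refine tendsto_finsetSum _ fun S _ => ?_
  by_cases hS : S = OFF
  · subst hS
    have hc0 : OFFᶜ = ON := by rw [hOFF, compl_compl]
    have hc' : c₀ OFF = (M₀.submatrix ((↑) : OFF → ι) ((↑) : OFF → ι)).det := by
      simp only [c₀, hc0, div_self hσON, one_mul]
    have hρ : ρ OFF = 1 := by simp only [ρ, hc0, div_self hrON.ne']
    have hif : (if OFF = OFF then (M₀.submatrix ((↑) : OFF → ι) ((↑) : OFF → ι)).det else 0)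
        = (M₀.submatrix ((↑) : OFF → ι) ((↑) : OFF → ι)).det := if_pos rfl
    rw [hif, ← hc']
    simp_rw [hρ, one_pow, mul_one]
    exact hc OFF
  · simp only [hS, if_false]
    have hρ0 : 0 ≤ ρ S := div_nonneg (Finset.prod_nonneg fun a _ => (hr a).le) hrON.le
    have hρ1 : ρ S < 1 := by
      rw [div_lt_one hrON]
      refine prod_lt_prod_on hr hr1 ?_
      intro h
      change Sᶜ = ON at h
      exact hS (by rw [hOFF, ← h, compl_compl])
    have := (hc S).mul (tendsto_pow_atTop_nhds_zero_of_lt_one hρ0 hρ1)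
    simpa using this

/-- **FLAG ASYMPTOTICS with a convergent base (sign form).**  If `M_D → M₀` and the `OFF`-minor `L` of `M₀` is nonzero, then for all large
`D` the determinant `det (M_D + diagonal (σ_a r_a^D))` has the sign of `(∏_{ON} σ_a) · L`. [folklore] -/
theorem eventually_det_mul_pos_of_tendsto (M : ℕ → Matrix ι ι ℝ) (M₀ : Matrix ι ι ℝ)
    (hM : Tendsto M atTop (𝓝 M₀)) (σ r : ι → ℝ) (hσ : ∀ a, σ a ≠ 0)
    (hr : ∀ a, 0 < r a) (hr1 : ∀ a, r a ≠ 1)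
    (hL : (M₀.submatrix ((↑) : ↥(univ.filter (fun a => 1 < r a))ᶜ → ι)
        ((↑) : ↥(univ.filter (fun a => 1 < r a))ᶜ → ι)).det ≠ 0) :
    ∀ᶠ D : ℕ in atTop, 0 < (M D + diagonal (fun a => σ a * r a ^ D)).det *
        ((∏ a ∈ univ.filter (fun a => 1 < r a), σ a) *
          (M₀.submatrix ((↑) : ↥(univ.filter (fun a => 1 < r a))ᶜ → ι)
            ((↑) : ↥(univ.filter (fun a => 1 < r a))ᶜ → ι)).det) := by
  set L := (M₀.submatrix ((↑) : ↥(univ.filter (fun a => 1 < r a))ᶜ → ι)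
    ((↑) : ↥(univ.filter (fun a => 1 < r a))ᶜ → ι)).det with hLdef
  have hlim := tendsto_det_add_diagonal_div_of_tendsto M M₀ hM σ r hσ hr hr1
  have hopen : IsOpen {y : ℝ | 0 < y * L} := isOpen_lt continuous_const (continuous_id.mul continuous_const)
  have hmem : L ∈ {y : ℝ | 0 < y * L} := by
    show 0 < L * L; exact mul_self_pos.mpr hL
  have hev := hlim.eventually (hopen.mem_nhds hmem)
  filter_upwards [hev] with D hD
  set P := ∏ a ∈ univ.filter (fun a => 1 < r a), (σ a * r a ^ D) with hPdef
  set q := (M D + diagonal (fun a => σ a * r a ^ D)).det / P with hq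
  have hD' : 0 < q * L := hD
  have hσON : ∏ a ∈ univ.filter (fun a => 1 < r a), σ a ≠ 0 := Finset.prod_ne_zero_iff.mpr fun a _ => hσ a
  have hrD : 0 < ∏ a ∈ univ.filter (fun a => 1 < r a), r a ^ D := Finset.prod_pos fun a _ => pow_pos (hr a) D
  have hP : P = (∏ a ∈ univ.filter (fun a => 1 < r a), σ a) * ∏ a ∈ univ.filter (fun a => 1 < r a), r a ^ D :=
    Finset.prod_mul_distrib
  have hPne : P ≠ 0 := by rw [hP]; exact mul_ne_zero hσON hrD.ne'
  have hdet : (M D + diagonal (fun a => σ a * r a ^ D)).det = q * P := by rw [hq, div_mul_cancel₀ _ hPne]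
  rw [hdet, hP]
  have hsq : 0 < (∏ a ∈ univ.filter (fun a => 1 < r a), σ a) * ∏ a ∈ univ.filter (fun a => 1 < r a), σ a :=
    mul_self_pos.mpr hσON
  have : q * ((∏ a ∈ univ.filter (fun a => 1 < r a), σ a) * ∏ a ∈ univ.filter (fun a => 1 < r a), r a ^ D) *
        ((∏ a ∈ univ.filter (fun a => 1 < r a), σ a) * L)
      = (q * L) * (((∏ a ∈ univ.filter (fun a => 1 < r a), σ a) *
          ∏ a ∈ univ.filter (fun a => 1 < r a), σ a) * ∏ a ∈ univ.filter (fun a => 1 < r a), r a ^ D) := by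
    ring
  rw [this]
  exact mul_pos hD' (mul_pos hsq hrD)

end Summit.ValiantsHypothesis.ValiantsHypothesis.Theorems.LacunarySymmetroidMatrixDescartes.Census.Flag
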